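import Literature.Topology.FourManifolds.DehnSurgeryFramingProofs
import Literature.Topology.FourManifolds.KnotGroupTubular
import Literature.Topology.FourManifolds.AlexanderModuleTrivializer
import Literature.AlgebraicTopology.FundamentalGroup.CircleAndTorus
import Mathlib.RingTheory.FiniteType
import Mathlib.Algebra.Ring.GeomSum
import HarnessLib

/-!
# The longitude of a knot lies in the second commutator subgroup of the knot group

Topic `Literature/Topology/FourManifolds`; written for the fact seat of Property R
(`Literature.Topology.FourManifolds.isUnknot_of_isIntegralSurgery_zero`), second step of the
classical *Alexander-module obstruction* (with `DehnSurgeryFundamentalGroup.lean`).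
**Everything in this file is proved; no definition of a `Prop`, no named fact.**

For a knot `K` with oriented tubular neighbourhood `ν` of framing `0`, write
`G = π₁(S³ ∖ K, p₀)`, `μ = [ν.meridian]`, `λ = [ν.longitude]`; `G' = commutator G` carries the
Alexander module `G'/G''` over `ℤ[Gᵃᵇ]` (`Literature.Topology.FourManifolds.alexanderModule`).

* `Knot.TubularNbhd.commute_meridian_longitude` — **`μ` and `λ` commute** (both loops lie on the
  torus `ν (𝕊¹ × ½𝕊¹)`, whose fundamental group is abelian: Hatcher, Prop. 1.12).
* `alexanderModule.smul_of_sub_one_surjective` / `…_injective` — for a finitely generated group `G`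
  whose abelianisation is generated by `t`, **multiplication by `t - 1` is a bijection of the
  Alexander module** (onto: `G' = [G, G']` for cyclic `Gᵃᵇ`; into: a surjective endomorphism of a
  finitely generated module over a commutative ring is injective — Vasconcelos/Orzech, Mathlib's
  `OrzechProperty.injective_of_surjective_endomorphism`).
* `alexanderModule.mk_eq_zero_of_commute`, `mem_commutator_commutator_of_commute` — hence an
  element of `G'` commuting with a lift of `t` dies in `G'/G''`, i.e. lies in `G''`.
* `Knot.TubularNbhd.longitude_mem_commutator_commutator` — **`λ ∈ G'' = ⁅G', G'⁆`** for a
  `0`-framed `ν` (`λ ∈ G'` is the framing condition; `Gᵃᵇ` is generated by `μ`,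
  `Knot.TubularNbhd.abelianization_mem_zpowers_meridian`; knot groups are finitely generated,
  `Knot.groupFG_of_tubularNbhd`).

The usual textbook proof of `λ ∈ G''` (Burde–Zieschang, *Knots*, Prop. 3.12; Rolfsen (1976), §5)
pushes `λ` onto a Seifert surface, whose fundamental group maps into `G'`, and uses that a
boundary curve is a product of commutators there.  The argument formalised here replaces the
Seifert surface by the algebra of the Alexander module: `(t - 1) · [λ] = [μ λ μ⁻¹] - [λ] = 0`
and `t - 1` acts injectively.  (Equivalently: the Alexander module of a knot has no
`(t - 1)`-torsion, the module form of `Δ_K(1) = ±1`, Crowell–Fox Ch. IX (1.2).)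

## References

* G. Burde, H. Zieschang, *Knots*, de Gruyter (1985), Prop. 3.12 (longitude in `G''`).
* R. H. Crowell, R. H. Fox, *Introduction to Knot Theory* (1963), Ch. VIII §3, Ch. IX (1.1)–(1.2).
  [CrowellFox1963]
* A. Hatcher, *Algebraic Topology* (2002), Prop. 1.12 (`π₁` of a product). [HatcherAT2002]
* W. V. Vasconcelos, *On finitely generated flat modules*, Trans. AMS 138 (1969) 505–512;
  M. Orzech, *Onto endomorphisms are isomorphisms*, Amer. Math. Monthly 78 (1971) 357–362
  (Mathlib `OrzechProperty`).

## Design notes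

* The algebraic lemmas are stated for an arbitrary group `G` (`[Group.FG G]` where needed) and an
  arbitrary generator `t` of `Gᵃᵇ`; the knot case instantiates `t = μᵃᵇ`.
* No definitions, no named facts, no `sorry`; the theorems depend only on `propext`,
  `Classical.choice`, `Quot.sound`.
-/

noncomputable section

open Set Function unitInterval
open scoped Topology Manifold Real commutatorElement

namespace Literature.Topology.FourManifolds

/-! ### Algebra: `t - 1` acts bijectively on the Alexander module -/

section Algebra

variable {G : Type*} [Group G]

/-- If `Gᵃᵇ` is generated by `t`, then `of t - 1` divides `of a - 1` in `ℤ[Gᵃᵇ]` for every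
`a ∈ Gᵃᵇ` (geometric sum; for negative powers `u⁻¹ - 1 = -u⁻¹ (u - 1)`). [folklore] -/
theorem of_sub_one_dvd_of_sub_one {t : Abelianization G} (ht : ∀ a : Abelianization G, a ∈ Subgroup.zpowers t)
    (a : Abelianization G) :
    (MonoidAlgebra.of ℤ (Abelianization G) t - 1) ∣ (MonoidAlgebra.of ℤ (Abelianization G) a - 1) := by
  obtain ⟨k, rfl⟩ := Subgroup.mem_zpowers_iff.1 (ht a)
  have hn : ∀ n : ℕ, (MonoidAlgebra.of ℤ (Abelianization G) t - 1) ∣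
      (MonoidAlgebra.of ℤ (Abelianization G) (t ^ n) - 1) := fun n => by
    rw [map_pow]
    simpa using sub_dvd_pow_sub_pow (MonoidAlgebra.of ℤ (Abelianization G) t) 1 n
  rcases Int.eq_nat_or_neg k with ⟨n, rfl | rfl⟩
  · rw [zpow_natCast]
    exact hn n
  · have h1 : MonoidAlgebra.of ℤ (Abelianization G) (t ^ (-(n : ℤ))) *
        MonoidAlgebra.of ℤ (Abelianization G) (t ^ n) = 1 := by
      rw [← map_mul, zpow_neg, zpow_natCast, inv_mul_cancel, map_one]
    have h : MonoidAlgebra.of ℤ (Abelianization G) (t ^ (-(n : ℤ))) - 1 =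
        -(MonoidAlgebra.of ℤ (Abelianization G) (t ^ (-(n : ℤ)))) *
          (MonoidAlgebra.of ℤ (Abelianization G) (t ^ n) - 1) := by
      rw [neg_mul, mul_sub, mul_one, h1]
      ring
    rw [h]
    exact (hn n).mul_left _

/-- The endomorphism "multiplication by `of t - 1`" of the Alexander module. [folklore] -/
theorem smul_of_sub_one_linearMap_apply (t : Abelianization G) (m : alexanderModule G) :
    ((MonoidAlgebra.of ℤ (Abelianization G) t - 1) •
      (LinearMap.id : alexanderModule G →ₗ[MonoidAlgebra ℤ (Abelianization G)] alexanderModule G)) m =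
      (MonoidAlgebra.of ℤ (Abelianization G) t - 1) • m := rfl

/-- The class of a commutator `⁅g, c⁆`, `c ∈ G'`, in the Alexander module is `(ḡ - 1) • [c]`
(Crowell–Fox Ch. VIII §3). [folklore] -/
theorem alexanderModule.mk_commutatorElement (g : G) {c : G} (hc : c ∈ commutator G)
    (hgc : ⁅g, c⁆ ∈ commutator G) :
    alexanderModule.mk ⟨⁅g, c⁆, hgc⟩ =
      (MonoidAlgebra.of ℤ (Abelianization G) (Abelianization.of g) - 1) •
        alexanderModule.mk ⟨c, hc⟩ := by
  rw [sub_smul, one_smul, alexanderModule.of_smul_mk, sub_eq_add_neg, ← alexanderModule.mk_inv,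
    ← alexanderModule.mk_mul]
  congr 1

/-- **`(t - 1) · (G'/G'') = G'/G''` when `Gᵃᵇ` is generated by `t`**: the range of multiplication by
`of t - 1` contains the classes of all commutators `⁅g, c⁆` (`c ∈ G'`), as
`[⁅g, c⁆] = (ḡ - 1)[c]` and `of t - 1 ∣ ḡ - 1`; and `G' = [G, G']` for cyclic `Gᵃᵇ`
(`commutator_le_of_isCyclic_abelianization`). Module form of Crowell–Fox Ch. IX (1.2).
[cite: CrowellFox1963, Ch. IX (1.2)] -/
theorem alexanderModule.smul_of_sub_one_surjective {t : Abelianization G}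
    (ht : ∀ a : Abelianization G, a ∈ Subgroup.zpowers t) :
    Function.Surjective fun m : alexanderModule G =>
      (MonoidAlgebra.of ℤ (Abelianization G) t - 1) • m := by
  haveI : IsCyclic (Abelianization G) := ⟨⟨t, ht⟩⟩
  let f : alexanderModule G →ₗ[MonoidAlgebra ℤ (Abelianization G)] alexanderModule G :=
    (MonoidAlgebra.of ℤ (Abelianization G) t - 1) • LinearMap.id
  suffices h : LinearMap.range f = ⊤ by
    intro m
    have hm : m ∈ LinearMap.range f := by rw [h]; exact Submodule.mem_top
    obtain ⟨m', hm'⟩ := hm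
    exact ⟨m', hm'⟩
  apply alexanderModule.eq_top_of_commutator_le_comap
  refine commutator_le_of_isCyclic_abelianization _ (alexanderModule.comap_le _) fun g c hc => ?_
  have hgc : ⁅g, c⁆ ∈ commutator G := by
    rw [commutatorElement_def]
    exact mul_mem ((inferInstance : (commutator G).Normal).conj_mem c hc g) (inv_mem hc)
  refine ⟨hgc, ?_⟩
  rw [alexanderModule.mk_commutatorElement g hc hgc]
  obtain ⟨q, hq⟩ := of_sub_one_dvd_of_sub_one ht (Abelianization.of g)
  rw [hq, mul_smul]
  exact ⟨q • alexanderModule.mk ⟨c, hc⟩, rfl⟩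

/-- **`t - 1` acts injectively on the Alexander module of a finitely generated group** whose
abelianisation is generated by `t`: the Alexander module is then finitely generated over the
commutative ring `ℤ[Gᵃᵇ]` (`alexanderModule.finite`), multiplication by `of t - 1` is onto
(`smul_of_sub_one_surjective`), and onto endomorphisms of finitely generated modules over
commutative rings are injective (Vasconcelos 1969 / Orzech 1971; Mathlib
`OrzechProperty.injective_of_surjective_endomorphism`). For knot groups this is the absence of
`(t - 1)`-torsion in the Alexander module (`Δ_K(1) = ±1`). [cite: CrowellFox1963, Ch. IX (1.2)] -/
theorem alexanderModule.smul_of_sub_one_injective [Group.FG G] {t : Abelianization G}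
    (ht : ∀ a : Abelianization G, a ∈ Subgroup.zpowers t) :
    Function.Injective fun m : alexanderModule G =>
      (MonoidAlgebra.of ℤ (Abelianization G) t - 1) • m := by
  let f : alexanderModule G →ₗ[MonoidAlgebra ℤ (Abelianization G)] alexanderModule G :=
    (MonoidAlgebra.of ℤ (Abelianization G) t - 1) • LinearMap.id
  exact OrzechProperty.injective_of_surjective_endomorphism f
    (alexanderModule.smul_of_sub_one_surjective ht)

/-- **An element of `G'` commuting with a lift of a generator of `Gᵃᵇ` dies in `G'/G''`**
(`G` finitely generated): `(ḡ - 1) · [c] = [g c g⁻¹] - [c] = 0` and `ḡ - 1` acts injectively.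
[folklore] -/
theorem alexanderModule.mk_eq_zero_of_commute [Group.FG G] {g c : G}
    (hg : ∀ a : Abelianization G, a ∈ Subgroup.zpowers (Abelianization.of g))
    (hc : c ∈ commutator G) (hcomm : Commute g c) :
    alexanderModule.mk ⟨c, hc⟩ = 0 := by
  apply alexanderModule.smul_of_sub_one_injective hg
  change (MonoidAlgebra.of ℤ (Abelianization G) (Abelianization.of g) - 1) • alexanderModule.mk ⟨c, hc⟩ =
    (MonoidAlgebra.of ℤ (Abelianization G) (Abelianization.of g) - 1) • (0 : alexanderModule G)
  rw [smul_zero, sub_smul, one_smul, alexanderModule.of_smul_mk, sub_eq_zero]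
  congr 1
  apply Subtype.ext
  rw [MulAut.conjNormal_apply]
  change g * c * g⁻¹ = c
  rw [hcomm.eq, mul_inv_cancel_right]

/-- `[c] = 0` in `G'/G''` iff `c ∈ G''`. [folklore] -/
theorem alexanderModule.mk_eq_zero_iff {c : commutator G} :
    alexanderModule.mk c = 0 ↔ c ∈ commutator (commutator G) := by
  rw [alexanderModule.mk, LinearEquiv.map_eq_zero_iff, ofMul_eq_zero]
  exact QuotientGroup.eq_one_iff c

/-- The second commutator subgroup `G'' ⊆ G'`, seen in `G`, is `⁅G', G'⁆`. [folklore] -/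
theorem mem_commutator_commutator_iff {c : commutator G} :
    c ∈ commutator (commutator G) ↔ (c : G) ∈ ⁅commutator G, commutator G⁆ := by
  have h : (commutator (commutator G)).map (commutator G).subtype = ⁅commutator G, commutator G⁆ := by
    rw [show commutator (commutator G) = ⁅(⊤ : Subgroup (commutator G)), ⊤⁆ from rfl,
      Subgroup.map_commutator, ← MonoidHom.range_eq_map, Subgroup.range_subtype]
  constructor
  · intro hc
    rw [← h]
    exact ⟨c, hc, rfl⟩
  · intro hc
    rw [← h] at hc
    obtain ⟨c', hc', hcc'⟩ := hc
    have : c' = c := Subtype.ext hcc'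
    exact this ▸ hc'

/-- **An element of `G'` commuting with a lift of a generator of `Gᵃᵇ` lies in `G'' = ⁅G', G'⁆`**
(`G` finitely generated). [folklore] -/
theorem mem_commutator_commutator_of_commute [Group.FG G] {g c : G}
    (hg : ∀ a : Abelianization G, a ∈ Subgroup.zpowers (Abelianization.of g))
    (hc : c ∈ commutator G) (hcomm : Commute g c) :
    c ∈ ⁅commutator G, commutator G⁆ :=
  mem_commutator_commutator_iff.1
    (alexanderModule.mk_eq_zero_iff.1 (alexanderModule.mk_eq_zero_of_commute hg hc hcomm))

end Algebra

/-! ### Geometry: the meridian and the longitude commute -/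

namespace Knot.TubularNbhd

variable {K : Knot} (ν : Knot.TubularNbhd K)

/-- The **half-radius torus map** `𝕊¹ × 𝕊¹ → S³ ∖ K`, `(u, v) ↦ ν (u, ½ v)`: the meridian and the
longitude of `ν` are the images of the two coordinate circles through `((1,0), (1,0))`.
[folklore] -/
theorem continuous_torusFun :
    Continuous fun q : (Metric.sphere (0 : EuclideanSpace ℝ (Fin 2)) 1) × (Metric.sphere (0 : EuclideanSpace ℝ (Fin 2)) 1) =>
      (⟨ν (q.1, (1 / 2 : ℝ) • (q.2 : EuclideanSpace ℝ (Fin 2))), ν.apply_mem_compl_range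
        (smul_ne_zero (by norm_num) (ne_zero_of_mem_unit_sphere q.2))⟩ : K.complement) := by
  refine Continuous.subtype_mk ?_ _
  refine ν.continuous.comp' (continuous_fst.prodMk ?_)
  exact (continuous_const (y := (1 / 2 : ℝ))).smul (continuous_subtype_val.comp' continuous_snd)

/-- **The meridian and the longitude of a tubular neighbourhood commute in the knot group**: they
are the images of the coordinate loops of the torus `𝕊¹ × 𝕊¹` under `(u, v) ↦ ν (u, ½ v)`, and
`π₁(𝕊¹ × 𝕊¹) ≅ π₁(𝕊¹) × π₁(𝕊¹)` (Hatcher, Prop. 1.12) makes the two coordinate loops commute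
(they are `(c, 1)` and `(1, c)` for the generator loop `c`). Rolfsen (1976), §3.A–B (peripheral subgroup).
[cite: HatcherAT2002, Prop. 1.12 (p. 34)] -/
theorem commute_meridian_longitude :
    Commute (FundamentalGroup.fromPath (Path.Homotopic.Quotient.mk ν.meridian) :
        FundamentalGroup K.complement ν.basePoint)
      (FundamentalGroup.fromPath (Path.Homotopic.Quotient.mk ν.longitude)) := by
  -- the torus map and the coordinate loop of the circle
  let τ : C((Metric.sphere (0 : EuclideanSpace ℝ (Fin 2)) 1) × (Metric.sphere (0 : EuclideanSpace ℝ (Fin 2)) 1), K.complement) :=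
    ⟨fun q => ⟨ν (q.1, (1 / 2 : ℝ) • (q.2 : EuclideanSpace ℝ (Fin 2))), ν.apply_mem_compl_range
      (smul_ne_zero (by norm_num) (ne_zero_of_mem_unit_sphere q.2))⟩, ν.continuous_torusFun⟩
  let x₀ : (Metric.sphere (0 : EuclideanSpace ℝ (Fin 2)) 1) := circlePoint 0
  have hτ : τ (x₀, x₀) = ν.basePoint := rfl
  let circ : Path x₀ x₀ :=
    { toFun := fun t => circlePt (t : ℝ)
      continuous_toFun := continuous_circlePt.comp continuous_subtype_val
      source' := by rw [Set.Icc.coe_zero, circlePt_eq_circlePoint, mul_zero]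
      target' := by rw [Set.Icc.coe_one, circlePt_one] }
  -- the two coordinate loops commute in `π₁(𝕊¹ × 𝕊¹)`
  let e := Literature.AlgebraicTopology.FundamentalGroup.fundamentalGroupProdEquiv x₀ x₀
  let a : FundamentalGroup (Metric.sphere (0 : EuclideanSpace ℝ (Fin 2)) 1) x₀ := FundamentalGroup.fromPath (Path.Homotopic.Quotient.mk circ)
  have hm : e.symm (1, a) =
      FundamentalGroup.fromPath (Path.Homotopic.Quotient.mk ((Path.refl x₀).prod circ)) :=
    Literature.AlgebraicTopology.FundamentalGroup.fundamentalGroupProdEquiv_symm_apply_mk x₀ x₀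
      (Path.refl x₀) circ
  have hl : e.symm (a, 1) =
      FundamentalGroup.fromPath (Path.Homotopic.Quotient.mk (circ.prod (Path.refl x₀))) :=
    Literature.AlgebraicTopology.FundamentalGroup.fundamentalGroupProdEquiv_symm_apply_mk x₀ x₀
      circ (Path.refl x₀)
  have hcomm : Commute (e.symm (1, a)) (e.symm (a, 1)) := by
    rw [Commute, SemiconjBy, ← map_mul, ← map_mul]
    congr 1
    exact Prod.ext (by simp) (by simp)
  rw [hm, hl] at hcomm
  -- push forward along `τ`
  have h1 := FundamentalGroup.mapOfEq_fromPath_eq τ hτ ((Path.refl x₀).prod circ) ν.meridian fun t => by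
    apply Subtype.ext
    rw [coe_meridian_apply]
    change _ = ν (circlePoint 0, (1 / 2 : ℝ) • ((circlePt (t : ℝ) : (Metric.sphere (0 : EuclideanSpace ℝ (Fin 2)) 1)) : EuclideanSpace ℝ (Fin 2)))
    rw [circlePt_eq_circlePoint]
  have h2 := FundamentalGroup.mapOfEq_fromPath_eq τ hτ (circ.prod (Path.refl x₀)) ν.longitude fun t => by
    apply Subtype.ext
    rw [coe_longitude_apply]
    change _ = ν (circlePt (t : ℝ), (1 / 2 : ℝ) • ((circlePoint 0 : (Metric.sphere (0 : EuclideanSpace ℝ (Fin 2)) 1)) : EuclideanSpace ℝ (Fin 2)))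
    rw [circlePt_eq_circlePoint]
    rfl
  rw [← h1, ← h2]
  exact hcomm.map _

/-- **The longitude of a `0`-framed tubular neighbourhood lies in the second commutator subgroup
`G'' = ⁅G', G'⁆` of the knot group `G = π₁(S³ ∖ K, p₀)`.** Framing `0` puts `λ` in `G'`; `Gᵃᵇ` is
generated by the meridian (`abelianization_mem_zpowers_meridian`), which commutes with `λ`
(`commute_meridian_longitude`); the knot group is finitely generated
(`Knot.groupFG_of_tubularNbhd`); so `mem_commutator_commutator_of_commute` applies. Classical
statement: Burde–Zieschang, *Knots*, Prop. 3.12; Rolfsen (1976), §5 (via a Seifert surface).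
[folklore] -/
theorem longitude_mem_commutator_commutator (h0 : ν.HasFraming 0) :
    (FundamentalGroup.fromPath (Path.Homotopic.Quotient.mk ν.longitude) :
        FundamentalGroup K.complement ν.basePoint) ∈
      ⁅commutator (FundamentalGroup K.complement ν.basePoint),
        commutator (FundamentalGroup K.complement ν.basePoint)⁆ := by
  haveI : Group.FG (FundamentalGroup K.complement ν.basePoint) :=
    Knot.groupFG_of_tubularNbhd ν ν.basePoint
  have hlam : (FundamentalGroup.fromPath (Path.Homotopic.Quotient.mk ν.longitude) :
      FundamentalGroup K.complement ν.basePoint) ∈ commutator _ := by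
    rw [← Abelianization.ker_of, MonoidHom.mem_ker]
    have h0' : Abelianization.of (FundamentalGroup.fromPath (Path.Homotopic.Quotient.mk ν.longitude)) =
        Abelianization.of (FundamentalGroup.fromPath (Path.Homotopic.Quotient.mk ν.meridian)) ^ (0 : ℤ) := h0
    rw [h0', zpow_zero]
  have hgen : ∀ a : Abelianization (FundamentalGroup K.complement ν.basePoint),
      a ∈ Subgroup.zpowers (Abelianization.of
        (FundamentalGroup.fromPath (Path.Homotopic.Quotient.mk ν.meridian))) := fun a => by
    induction a using QuotientGroup.induction_on with
    | H g => exact ν.abelianization_mem_zpowers_meridian g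
  exact mem_commutator_commutator_of_commute hgen hlam ν.commute_meridian_longitude

/-- The longitude of a `0`-framed tubular neighbourhood lies in the commutator subgroup `G'`
(this is the framing condition) and its class in the Alexander module `G'/G''` vanishes.
[folklore] -/
theorem alexanderModule_mk_longitude_eq_zero (h0 : ν.HasFraming 0) :
    ∃ hlam : (FundamentalGroup.fromPath (Path.Homotopic.Quotient.mk ν.longitude) :
        FundamentalGroup K.complement ν.basePoint) ∈ commutator _,
      alexanderModule.mk ⟨_, hlam⟩ = 0 := by
  haveI : Group.FG (FundamentalGroup K.complement ν.basePoint) :=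
    Knot.groupFG_of_tubularNbhd ν ν.basePoint
  have hlam : (FundamentalGroup.fromPath (Path.Homotopic.Quotient.mk ν.longitude) :
      FundamentalGroup K.complement ν.basePoint) ∈ commutator _ := by
    rw [← Abelianization.ker_of, MonoidHom.mem_ker]
    have h0' : Abelianization.of (FundamentalGroup.fromPath (Path.Homotopic.Quotient.mk ν.longitude)) =
        Abelianization.of (FundamentalGroup.fromPath (Path.Homotopic.Quotient.mk ν.meridian)) ^ (0 : ℤ) := h0
    rw [h0', zpow_zero]
  have hgen : ∀ a : Abelianization (FundamentalGroup K.complement ν.basePoint),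
      a ∈ Subgroup.zpowers (Abelianization.of
        (FundamentalGroup.fromPath (Path.Homotopic.Quotient.mk ν.meridian))) := fun a => by
    induction a using QuotientGroup.induction_on with
    | H g => exact ν.abelianization_mem_zpowers_meridian g
  exact ⟨hlam, alexanderModule.mk_eq_zero_of_commute hgen hlam ν.commute_meridian_longitude⟩

end Knot.TubularNbhd

end Literature.Topology.FourManifolds
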